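import Literature.Computability.Complexity.HankelHitter
import Literature.Computability.Complexity.LupanovBound
import Literature.Computability.Complexity.HardCoreLemma
import Mathlib.Algebra.BigOperators.Field
import HarnessLib

/-!
# The Impagliazzo–Wigderson derandomized XOR construction, I: the code, biases, expected bias

Topic `Computability/Complexity`. First file of the formalisation of Hirahara's Lemma 8.1 (ECCC
TR22-119, p. 24–25) — the derandomized XOR lemma of Impagliazzo–Wigderson 1997 "instantiated with a
pairwise-independent hitter", viewed as a locally encodable, approximately list-decodable code — along
the simplified proof of Healy–Vadhan–Viola 2006 as reviewed by Hirahara (CCC 2020, App. A, Thm. 56,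
Def. 69, Lemmas 71–74). Everything in this file is proved.

The code (`IWAmp.amp`). For `f : {0,1}ᴺ → {0,1}`, blocks `e i : Fin N ↪ Fin d` (`i < k`, a "nearly
disjoint" family) and the Hankel pairwise-independent generator `Hit` (`HankelHitter.lean`) indexed by
`idx : Fin k → 𝔽₂ᵐ`, a seed is `σ = (x, y)`, `x ∈ {0,1}ᵈ`, `y` a Hankel seed, the `i`-th input is
`wᵢ(σ) = x|_{Sᵢ} ⊕ Hit(y)ᵢ` (`IWAmp.inp`) and `Amp^f(σ) = ⊕_{i<k} f(wᵢ(σ))` (Hir20a Def. 69: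
`Amp^f := f^{⊕k} ∘ IW`, `IW(x,y) = ND(x) ⊕ Hit(y)`).

Results:
* `IWAmp.negOnePow_parityFin`, `IWAmp.sum_negOnePow_parity_eq_prod` — the bias of an XOR of
  independent bits is the product of the biases (HVV Lemma 3.4 in counting form);
* `IWAmp.fM` — the probabilistic function `f_M` of a capped measure `M : {0,1}ᴺ → [0, C]` (random bit
  with probability `M(v)/C`, else `f v`; Hir20a App. A: `f_H`), `card_fM_sub` (its bias at `v` is
  `2(C - M v)` out of `2C`);
* `IWAmp.card_parity_fM_le` — for a FIXED seed, `#{ω | ⊕ᵢ f_M(wᵢ, ωᵢ) = c} ≤ |Ω|ᵏ/2 · (1 + ∏ᵢ (1 - M(wᵢ)/C))`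
  (HVV Lemma 3.4);
* `IWAmp.sum_prod_one_sub_le` — **the expected bias is small** (Hir20a Lemma 72, measure version):
  if `idx` is injective and `∑ M ≥ δ C 2ᴺ` then `∑_σ ∏ᵢ (1 - M(wᵢ(σ))/C) ≤ 6 |Seed| / (k δ)`, by the
  hitting property of the Hankel generator (Chebyshev) and `∏(1-mᵢ) ≤ 1/(1+∑mᵢ)`;
* `IWAmp.exists_predictor_of_gap` — **from distinguishing `(v, f v)` vs `(v, f_M(v))` to predicting `f`
  on `M`** (Hir20a Prop. 70, counting form): a gap `η` yields a predictor with
  `∑ᵥ M(v) σ_P(v) ≥ 2 C 2ᴺ η` (`σ_P = ±1` the correctness sign of `HardCoreLemma.lean`).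

## References

* S. Hirahara, *NP-hardness of learning programs and partial MCSP*, ECCC TR22-119, Lemma 8.1 and its
  proof (pp. 24–25) [Hirahara2022PartialMCSP].
* S. Hirahara, *Non-disjoint promise problems from meta-computational view of PRG constructions*,
  CCC 2020 (LIPIcs 169), App. A: Thm. 56, Lemma 68, Def. 69, Prop. 70, Lemmas 71–74
  (`lit read doi:10.4230/LIPIcs.CCC.2020.20`, pp. 44–46).
* A. Healy, S. Vadhan, E. Viola, *Using nondeterminism to amplify hardness*, SIAM J. Comput. 35 (2006)
  (ECCC TR04-087), Lemma 3.4, §5.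
* R. Impagliazzo, A. Wigderson, *P = BPP if E requires exponential circuits: derandomizing the XOR
  lemma*, STOC 1997.
-/

namespace Literature.Computability.Complexity

open Finset

namespace IWAmp

variable {N d m k : ℕ}

/-! ### The construction -/

/-- Seeds `σ = (x, y)`: the nearly-disjoint-generator seed `x ∈ {0,1}ᵈ` and a Hankel seed `y`.
[cite: Hirahara2022PartialMCSP, proof of Lemma 8.1 (z ∈ {0,1}^d, r ∈ {0,1}^{3n})] -/
abbrev Seed (N d m : ℕ) : Type := (Fin d → Bool) × Hankel.Seed N m

/-- The hitter samples as Boolean vectors. [cite: Hirahara2022PartialMCSP, proof of Lemma 8.1 (H(r)ᵢ)] -/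
def hitB (idx : Fin k → Fin m → ZMod 2) (y : Hankel.Seed N m) (i : Fin k) : Fin N → Bool :=
  fun r => decide (Hankel.gen idx y i r ≠ 0)

/-- The `i`-th input `wᵢ(σ) = x|_{Sᵢ} ⊕ Hit(y)ᵢ`. [cite: Hirahara2022PartialMCSP, proof of Lemma 8.1 (z_{Sᵢ} ⊕ H(r)ᵢ)] -/
def inp (e : Fin k → (Fin N ↪ Fin d)) (idx : Fin k → Fin m → ZMod 2) (i : Fin k) (σ : Seed N d m) :
    Fin N → Bool :=
  fun r => xor (σ.1 (e i r)) (hitB idx σ.2 i r)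

/-- **The amplified function** `Amp^f(σ) = ⊕_{i<k} f(wᵢ(σ))`. [cite: Hirahara2022PartialMCSP, proof of Lemma 8.1 (f̂(z,r) := f(z_{S₁} ⊕ H(r)₁) ⊕ ⋯ ⊕ f(z_{S_k} ⊕ H(r)_k))] -/
def amp (e : Fin k → (Fin N ↪ Fin d)) (idx : Fin k → Fin m → ZMod 2) (f : (Fin N → Bool) → Bool)
    (σ : Seed N d m) : Bool :=
  parityFin k fun i => f (inp e idx i σ)

/-! ### Biases of XORs of independent bits -/

/-- `χ(b) = (-1)^b`. [folklore] -/
def negOnePow (b : Bool) : ℤ := if b then -1 else 1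

/-- `χ(1) = -1`. [folklore] -/
@[simp] theorem negOnePow_true : negOnePow true = -1 := rfl
/-- `χ(0) = 1`. [folklore] -/
@[simp] theorem negOnePow_false : negOnePow false = 1 := rfl

/-- `χ(a ⊕ b) = χ(a) χ(b)`. [folklore] -/
theorem negOnePow_xor (a b : Bool) : negOnePow (xor a b) = negOnePow a * negOnePow b := by
  cases a <;> cases b <;> rfl

/-- `χ(⊕ᵢ zᵢ) = ∏ᵢ χ(zᵢ)`. [folklore] -/
theorem negOnePow_parityFin : ∀ (k : ℕ) (z : Fin k → Bool),
    negOnePow (parityFin k z) = ∏ i, negOnePow (z i)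
  | 0, z => by simp [parityFin]
  | k + 1, z => by
    rw [parityFin, negOnePow_xor, negOnePow_parityFin k, Fin.prod_univ_castSucc]

/-- `#{false} - #{true} = ∑ χ`. [folklore] -/
theorem card_sub_card_eq_sum {α : Type*} [Fintype α] (g : α → Bool) :
    ((univ.filter fun a => g a = false).card : ℤ) - (univ.filter fun a => g a = true).card =
      ∑ a, negOnePow (g a) := by
  have h : ∀ a, negOnePow (g a) = (if g a = false then (1 : ℤ) else 0) - (if g a = true then 1 else 0) :=
    fun a => by cases g a <;> simp
  simp_rw [h, Finset.sum_sub_distrib, ← Finset.sum_filter, sum_const, nsmul_eq_mul, mul_one]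

/-- **Bias of an XOR of independent bits = product of the biases** (HVV Lemma 3.4, counting form):
for bits `Bᵢ(ωᵢ)` of independent uniform `ωᵢ ∈ Ω`,
`#{ω | ⊕ᵢ Bᵢ(ωᵢ) = 0} - #{ω | ⊕ᵢ Bᵢ(ωᵢ) = 1} = ∏ᵢ (#{o | Bᵢ o = 0} - #{o | Bᵢ o = 1})`.
[cite: Hirahara2022PartialMCSP, proof of Lemma 8.1 (via [HVV06], Lemma 3.4)] -/
theorem card_parity_sub_eq_prod {Ω : Type*} [Fintype Ω] (k : ℕ) (B : Fin k → Ω → Bool) :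
    ((univ.filter fun ω : Fin k → Ω => parityFin k (fun i => B i (ω i)) = false).card : ℤ) -
        (univ.filter fun ω : Fin k → Ω => parityFin k (fun i => B i (ω i)) = true).card =
      ∏ i, (((univ.filter fun o => B i o = false).card : ℤ) - (univ.filter fun o => B i o = true).card) := by
  rw [card_sub_card_eq_sum]
  simp_rw [negOnePow_parityFin, card_sub_card_eq_sum]
  exact (Fintype.prod_sum fun i o => negOnePow (B i o)).symm

/-! ### The probabilistic function `f_M` -/

/-- The probabilistic function `f_M` of a capped measure `M : {0,1}ᴺ → {0, …, C}`: on randomness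
`ω = (t, c) ∈ Fin C × {0,1}`, output the random bit `c` if `t < M v` (probability `M(v)/C`) and `f v`
otherwise (Hir20a App. A: `f_H` for a hard-core SET `H`; here the measure version).
[cite: Hirahara2022PartialMCSP, proof of Lemma 8.1 (via Hir20a, App. A, f_H)] -/
def fM (C : ℕ) (M : (Fin N → Bool) → ℕ) (f : (Fin N → Bool) → Bool) (v : Fin N → Bool)
    (ω : Fin C × Bool) : Bool :=
  if (ω.1 : ℕ) < M v then ω.2 else f v

/-- The bias of `f_M` at `v`: `#{ω | f_M(v,ω) = 0} - #{ω | f_M(v,ω) = 1} = 2 χ(f v) (C - M v)` (out of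
`|Ω| = 2C`; for `M v ≤ C`). [cite: Hirahara2022PartialMCSP, proof of Lemma 8.1 (via Hir20a, App. A: Bias(f_H(x)))] -/
theorem card_fM_sub {C : ℕ} {M : (Fin N → Bool) → ℕ} (f : (Fin N → Bool) → Bool) (v : Fin N → Bool)
    (hM : M v ≤ C) :
    ((univ.filter fun ω : Fin C × Bool => fM C M f v ω = false).card : ℤ) -
        (univ.filter fun ω : Fin C × Bool => fM C M f v ω = true).card =
      2 * negOnePow (f v) * (C - M v : ℤ) := by
  rw [card_sub_card_eq_sum, Fintype.sum_prod_type]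
  -- split `t < M v` (contributes `χ(0)+χ(1) = 0`) from `t ≥ M v` (contributes `2 χ(f v)`)... per `t`
  have ht : ∀ t : Fin C, ∑ c : Bool, negOnePow (fM C M f v (t, c)) =
      if t.val < M v then 0 else 2 * negOnePow (f v) := by
    intro t
    simp only [fM, Fintype.sum_bool]
    split_ifs with h
    · simp
    · ring
  simp_rw [ht]
  rw [Finset.sum_ite, Finset.sum_const_zero, zero_add, sum_const, nsmul_eq_mul]
  have hc : ((univ : Finset (Fin C)).filter fun t : Fin C => ¬t.val < M v).card = C - M v := by
    have hlt : ((univ : Finset (Fin C)).filter fun t : Fin C => t.val < M v).card = M v := by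
      rw [Fin.card_filter_val_lt, min_eq_right hM]
    have := Finset.card_filter_add_card_filter_not
      (s := (univ : Finset (Fin C))) (fun t : Fin C => t.val < M v)
    rw [hlt, card_univ, Fintype.card_fin] at this
    omega
  rw [hc]
  push_cast [hM]
  ring

/-- **HVV Lemma 3.4 for `f_M`**: for FIXED inputs `w₀, …, w_{k-1}` and any target bit `c`,
`2 · #{ω | ⊕ᵢ f_M(wᵢ, ωᵢ) = c} ≤ (2C)ᵏ + ∏ᵢ 2 (C - M wᵢ)`, i.e.
`Pr_ω[⊕ᵢ f_M(wᵢ,ωᵢ) = c] ≤ ½ (1 + ∏ᵢ (1 - M(wᵢ)/C))`. [cite: Hirahara2022PartialMCSP, proof of Lemma 8.1 (via [HVV06] Lemma 3.4 / Hir20a Lemma 71: "½ + ½ ExpBias")] -/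
theorem two_mul_card_parity_fM_le {C : ℕ} {M : (Fin N → Bool) → ℕ} (hM : ∀ v, M v ≤ C)
    (f : (Fin N → Bool) → Bool) (w : Fin k → Fin N → Bool) (c : Bool) :
    2 * ((univ.filter fun ω : Fin k → Fin C × Bool =>
        parityFin k (fun i => fM C M f (w i) (ω i)) = c).card : ℤ) ≤
      (2 * C : ℤ) ^ k + ∏ i, (2 * (C - M (w i)) : ℤ) := by
  set F := ((univ.filter fun ω : Fin k → Fin C × Bool =>
    parityFin k (fun i => fM C M f (w i) (ω i)) = false).card : ℤ) with hF
  set T := ((univ.filter fun ω : Fin k → Fin C × Bool =>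
    parityFin k (fun i => fM C M f (w i) (ω i)) = true).card : ℤ) with hT
  have hsum : F + T = (2 * C : ℤ) ^ k := by
    have h := Finset.card_filter_add_card_filter_not (s := (univ : Finset (Fin k → Fin C × Bool)))
      (fun ω => parityFin k (fun i => fM C M f (w i) (ω i)) = false)
    rw [card_univ, Fintype.card_fun, Fintype.card_prod, Fintype.card_fin, Fintype.card_bool,
      Fintype.card_fin] at h
    have hT' : ((univ : Finset (Fin k → Fin C × Bool)).filter fun ω =>
        ¬parityFin k (fun i => fM C M f (w i) (ω i)) = false) =
        univ.filter fun ω => parityFin k (fun i => fM C M f (w i) (ω i)) = true := by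
      ext ω; simp
    rw [hT'] at h
    have : (F + T : ℤ) = ((C * 2) ^ k : ℕ) := by rw [hF, hT]; exact_mod_cast h
    rw [this]; push_cast; ring
  have hdiff : F - T = ∏ i, (2 * negOnePow (f (w i)) * (C - M (w i)) : ℤ) := by
    rw [hF, hT, card_parity_sub_eq_prod]
    exact Finset.prod_congr rfl fun i _ => card_fM_sub f (w i) (hM _)
  -- `|F - T| ≤ ∏ 2 (C - M wᵢ)`
  have habs : |F - T| ≤ ∏ i, (2 * (C - M (w i)) : ℤ) := by
    rw [hdiff, Finset.abs_prod]
    refine Finset.prod_le_prod (fun i _ => abs_nonneg _) fun i _ => le_of_eq ?_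
    have hCM : (0 : ℤ) ≤ C - M (w i) := by have := hM (w i); omega
    rw [abs_mul, abs_mul, abs_of_nonneg hCM, abs_two]
    rcases Bool.eq_false_or_eq_true (f (w i)) with h | h <;> rw [h] <;> simp
  cases c
  · -- `2F = (F+T) + (F-T)`
    have : 2 * F = (F + T) + (F - T) := by ring
    rw [this, hsum]; linarith [le_abs_self (F - T)]
  · have : 2 * T = (F + T) - (F - T) := by ring
    rw [this, hsum]; linarith [neg_abs_le (F - T)]

/-! ### The expected bias is small (hitting) -/

/-- `∏ᵢ (1 - mᵢ) · (1 + ∑ᵢ mᵢ) ≤ 1` for `mᵢ ∈ [0,1]`. [folklore] -/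
theorem prod_one_sub_mul_le {ι : Type*} (s : Finset ι) (μ : ι → ℝ) (h0 : ∀ i ∈ s, 0 ≤ μ i)
    (h1 : ∀ i ∈ s, μ i ≤ 1) : (∏ i ∈ s, (1 - μ i)) * (1 + ∑ i ∈ s, μ i) ≤ 1 := by
  classical
  induction s using Finset.induction_on with
  | empty => simp
  | insert a s ha ih =>
    rw [Finset.prod_insert ha, Finset.sum_insert ha]
    have hP : 0 ≤ ∏ i ∈ s, (1 - μ i) := Finset.prod_nonneg fun i hi => by
      linarith [h1 i (Finset.mem_insert_of_mem hi)]
    have ih' := ih (fun i hi => h0 i (Finset.mem_insert_of_mem hi))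
      (fun i hi => h1 i (Finset.mem_insert_of_mem hi))
    have ha0 := h0 a (Finset.mem_insert_self a s)
    have ha1 := h1 a (Finset.mem_insert_self a s)
    have hS : 0 ≤ ∑ i ∈ s, μ i := Finset.sum_nonneg fun i hi => h0 i (Finset.mem_insert_of_mem hi)
    -- `(1-m)(1+S+m) ≤ 1+S`
    have hstep : (1 - μ a) * (1 + (μ a + ∑ i ∈ s, μ i)) ≤ 1 + ∑ i ∈ s, μ i := by nlinarith
    calc (1 - μ a) * (∏ i ∈ s, (1 - μ i)) * (1 + (μ a + ∑ i ∈ s, μ i))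
        = (∏ i ∈ s, (1 - μ i)) * ((1 - μ a) * (1 + (μ a + ∑ i ∈ s, μ i))) := by ring
      _ ≤ (∏ i ∈ s, (1 - μ i)) * (1 + ∑ i ∈ s, μ i) := mul_le_mul_of_nonneg_left hstep hP
      _ ≤ 1 := ih'

/-- Uniformity is preserved by post-composing each map with a bijection onto a type of the same size.
[folklore] -/
theorem uniform_transport {Y V V' : Type*} [Fintype Y] [Fintype V] [Fintype V'] [DecidableEq V]
    [DecidableEq V'] {X : Fin k → Y → V} (h1 : PairwiseUniform.Uniform1 X)
    (h2 : PairwiseUniform.Uniform2 X) (τ : Fin k → V ≃ V') :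
    PairwiseUniform.Uniform1 (fun i y => τ i (X i y)) ∧
      PairwiseUniform.Uniform2 (fun i y => τ i (X i y)) := by
  constructor
  · intro i v'
    have hs : (univ.filter fun y => τ i (X i y) = v') = univ.filter fun y => X i y = (τ i).symm v' := by
      ext y; simp [Equiv.apply_eq_iff_eq_symm_apply]
    rw [hs, Fintype.card_congr (τ i).symm]
    exact h1 i _
  · intro i j hij v' w'
    have hs : (univ.filter fun y => τ i (X i y) = v' ∧ τ j (X j y) = w') =
        univ.filter fun y => X i y = (τ i).symm v' ∧ X j y = (τ j).symm w' := by
      ext y; simp [Equiv.apply_eq_iff_eq_symm_apply]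
    rw [hs, Fintype.card_congr (τ i).symm]
    exact h2 i j hij _ _

/-- The inputs `wᵢ(x, y)` for a fixed `x`, as the Hankel samples read through the bijections
`z ↦ x|_{Sᵢ} ⊕ z̄`. [cite: Hirahara2022PartialMCSP, proof of Lemma 8.1 (via Hir20a Lemma 72: Hᵢ := ND(x)ᵢ ⊕ H)] -/
def shiftEquiv (e : Fin k → (Fin N ↪ Fin d)) (x : Fin d → Bool) (i : Fin k) :
    (Fin N → ZMod 2) ≃ (Fin N → Bool) where
  toFun z r := xor (x (e i r)) (decide (z r ≠ 0))
  invFun v r := if xor (x (e i r)) (v r) then 1 else 0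
  left_inv z := by
    funext r
    have hz : z r = 0 ∨ z r = 1 := by
      have : ∀ a : ZMod 2, a = 0 ∨ a = 1 := by decide
      exact this _
    rcases hz with h | h <;> cases x (e i r) <;> simp [h]
  right_inv v := by
    funext r
    cases hx : x (e i r) <;> cases hv : v r <;> simp [hx, hv]

/-- `wᵢ(x, y)` is the Hankel sample read through `shiftEquiv`. [folklore] -/
theorem inp_eq_shiftEquiv (e : Fin k → (Fin N ↪ Fin d)) (idx : Fin k → Fin m → ZMod 2) (i : Fin k)
    (x : Fin d → Bool) (y : Hankel.Seed N m) :
    inp e idx i (x, y) = shiftEquiv e x i (Hankel.gen idx y i) := rfl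

/-- **The expected bias is small** (Hir20a Lemma 72, measure version, via the Hankel hitter): for an
injective indexing and a capped measure `M ≤ C` of density `δ` (`δ C 2ᴺ ≤ ∑ M`),
`∑_σ ∏ᵢ (1 - M(wᵢ(σ))/C) ≤ 6 |Seed| / (k δ)`. Proof: for each `x`, over the Hankel seed the inputs
`wᵢ` are pairwise independent uniform, so by Chebyshev all but a `4/(k μ̄)` fraction collect mass
`∑ᵢ mᵢ > k μ̄/2` (`μ̄ ≥ δ` the mean of `m = M/C`), where `∏(1 - mᵢ) ≤ 1/(1 + ∑ mᵢ) < 2/(k μ̄)`.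
[cite: Hirahara2022PartialMCSP, proof of Lemma 8.1 (via Hir20a Lemma 72 "ExpBias[f_H^{⊕k} ∘ IW] ≤ ε", Lemma 68 hitter)] -/
theorem sum_prod_one_sub_le (e : Fin k → (Fin N ↪ Fin d)) {idx : Fin k → Fin m → ZMod 2}
    (hidx : Function.Injective idx) {C : ℕ} (hC : 0 < C) {M : (Fin N → Bool) → ℕ} (hM : ∀ v, M v ≤ C)
    {δ : ℝ} (hδ : 0 < δ) (hk : 0 < k)
    (hdense : δ * C * Fintype.card (Fin N → Bool) ≤ ∑ v, (M v : ℝ)) :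
    ∑ σ : Seed N d m, ∏ i, (1 - (M (inp e idx i σ) : ℝ) / C) ≤
      6 * Fintype.card (Seed N d m) / (k * δ) := by
  have hCR : (0 : ℝ) < C := by exact_mod_cast hC
  have hkR : (0 : ℝ) < k := by exact_mod_cast hk
  set μ : (Fin N → Bool) → ℝ := fun v => (M v : ℝ) / C with hμ
  have hμ0 : ∀ v, 0 ≤ μ v := fun v => by positivity
  have hμ1 : ∀ v, μ v ≤ 1 := fun v => by
    rw [hμ, div_le_one hCR]; exact_mod_cast hM v
  set V := Fintype.card (Fin N → Bool) with hV
  have hVpos : (0 : ℝ) < V := by rw [hV]; exact_mod_cast Fintype.card_pos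
  set mbar := (∑ v, μ v) / V with hmbar_def
  have hδm : δ ≤ mbar := by
    rw [hmbar_def, le_div_iff₀ hVpos]
    have : ∑ v, μ v = (∑ v, (M v : ℝ)) / C := by rw [hμ, Finset.sum_div]
    rw [this, le_div_iff₀ hCR]
    linarith
  have hmbar0 : 0 < mbar := hδ.trans_le hδm
  set E := (k : ℝ) * mbar with hE
  have hEpos : 0 < E := by positivity
  -- the bound for each fixed `x`
  have hx : ∀ x : Fin d → Bool,
      ∑ y : Hankel.Seed N m, ∏ i, (1 - μ (inp e idx i (x, y))) ≤
        6 * Fintype.card (Hankel.Seed N m) / E := by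
    intro x
    obtain ⟨h1, h2⟩ := Hankel.uniform_gen (N := N) hidx
    obtain ⟨h1', h2'⟩ := uniform_transport h1 h2 (shiftEquiv e x)
    have hcheb := PairwiseUniform.card_sum_le_half_mul_le h1' h2' μ hμ0 hμ1 Fintype.card_pos
    simp only [← inp_eq_shiftEquiv] at hcheb
    rw [← hV, ← hmbar_def, ← hE] at hcheb
    set Yc := (Fintype.card (Hankel.Seed N m) : ℝ)
    set bad := univ.filter fun y : Hankel.Seed N m => ∑ i, μ (inp e idx i (x, y)) ≤ E / 2 with hbad
    -- split the sum over `bad` and its complement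
    have hsplit := Finset.sum_filter_add_sum_filter_not (univ : Finset (Hankel.Seed N m))
      (fun y => ∑ i, μ (inp e idx i (x, y)) ≤ E / 2) (fun y => ∏ i, (1 - μ (inp e idx i (x, y))))
    rw [← hsplit, ← hbad]
    have hP1 : ∀ y, ∏ i, (1 - μ (inp e idx i (x, y))) ≤ 1 := fun y =>
      Finset.prod_le_one (fun i _ => by linarith [hμ1 (inp e idx i (x, y))])
        fun i _ => by linarith [hμ0 (inp e idx i (x, y))]
    have hP0 : ∀ y, 0 ≤ ∏ i, (1 - μ (inp e idx i (x, y))) := fun y =>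
      Finset.prod_nonneg fun i _ => by linarith [hμ1 (inp e idx i (x, y))]
    -- on `bad`: each term `≤ 1`, and `#bad · E ≤ 4 |Y|`
    have hb : ∑ y ∈ bad, ∏ i, (1 - μ (inp e idx i (x, y))) ≤ 4 * Yc / E := by
      calc ∑ y ∈ bad, ∏ i, (1 - μ (inp e idx i (x, y))) ≤ ∑ _y ∈ bad, (1 : ℝ) :=
            sum_le_sum fun y _ => hP1 y
        _ = bad.card := by rw [sum_const, nsmul_eq_mul, mul_one]
        _ ≤ 4 * Yc / E := by rw [le_div_iff₀ hEpos]; exact hcheb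
    -- off `bad`: each term `≤ 1/(1 + E/2) ≤ 2/E`
    have hg : ∑ y ∈ univ.filter (fun y => ¬∑ i, μ (inp e idx i (x, y)) ≤ E / 2),
        ∏ i, (1 - μ (inp e idx i (x, y))) ≤ 2 * Yc / E := by
      calc ∑ y ∈ univ.filter (fun y => ¬∑ i, μ (inp e idx i (x, y)) ≤ E / 2),
            ∏ i, (1 - μ (inp e idx i (x, y)))
          ≤ ∑ _y ∈ univ.filter (fun y => ¬∑ i, μ (inp e idx i (x, y)) ≤ E / 2), 2 / E :=
            sum_le_sum fun y hy => by
              have hgt := (mem_filter.1 hy).2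
              rw [not_le] at hgt
              have h := prod_one_sub_mul_le univ (fun i => μ (inp e idx i (x, y)))
                (fun i _ => hμ0 _) (fun i _ => hμ1 _)
              -- `P (1 + S) ≤ 1`, `S > E/2` ⇒ `P ≤ 1/(1+S) ≤ 2/E`
              rw [le_div_iff₀ hEpos]
              have hS : E / 2 < ∑ i, μ (inp e idx i (x, y)) := hgt
              nlinarith [hP0 y]
        _ = ((univ.filter fun y => ¬∑ i, μ (inp e idx i (x, y)) ≤ E / 2).card : ℝ) * (2 / E) := by
            rw [sum_const, nsmul_eq_mul]
        _ ≤ Yc * (2 / E) := by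
            gcongr
            have : ((univ.filter fun y => ¬∑ i, μ (inp e idx i (x, y)) ≤ E / 2).card : ℝ) ≤
                Fintype.card (Hankel.Seed N m) := by exact_mod_cast card_le_univ _
            exact this
        _ = 2 * Yc / E := by ring
    calc _ ≤ 4 * Yc / E + 2 * Yc / E := add_le_add hb hg
      _ = 6 * Fintype.card (Hankel.Seed N m) / E := by ring
  -- sum over `x`
  calc ∑ σ : Seed N d m, ∏ i, (1 - (M (inp e idx i σ) : ℝ) / C)
      = ∑ x : Fin d → Bool, ∑ y : Hankel.Seed N m, ∏ i, (1 - μ (inp e idx i (x, y))) := by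
        rw [Fintype.sum_prod_type]
    _ ≤ ∑ _x : Fin d → Bool, 6 * Fintype.card (Hankel.Seed N m) / E := sum_le_sum fun x _ => hx x
    _ = Fintype.card (Fin d → Bool) * (6 * Fintype.card (Hankel.Seed N m) / E) := by
        rw [sum_const, card_univ, nsmul_eq_mul]
    _ = 6 * Fintype.card (Seed N d m) / E := by
        have hcardS : (Fintype.card (Seed N d m) : ℝ) =
            Fintype.card (Fin d → Bool) * Fintype.card (Hankel.Seed N m) := by
          exact_mod_cast Fintype.card_prod _ _
        rw [hcardS]; ring
    _ ≤ 6 * Fintype.card (Seed N d m) / (k * δ) := by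
        apply div_le_div_of_nonneg_left (by positivity) (by positivity)
        rw [hE]; exact mul_le_mul_of_nonneg_left hδm hkR.le

/-! ### From a one-query distinguisher to a predictor (Prop. 70) -/

/-- `[b] ∈ {0,1} ⊆ ℤ`. [folklore] -/
def b2i (b : Bool) : ℤ := if b then 1 else 0

/-- The predictor extracted from a one-query distinguisher `A(v, ·)`: answer the unique accepted bit
if there is one, else the tie-break bit `c`. [cite: Hirahara2022PartialMCSP, proof of Lemma 8.1 (via Hir20a Prop. 70: "a one-query oracle circuit of size O(1)")] -/
def pred (A : (Fin N → Bool) → Bool → Bool) (c : Bool) (v : Fin N → Bool) : Bool :=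
  if A v true = A v false then c else A v true

/-- **The gap identity**: `2C · ∑ᵥ [A(v, f v)] - ∑ᵥ ∑_ω [A(v, f_M(v,ω))] = ∑ᵥ M(v) ([A(v,f v)] - [A(v, ¬f v)])`.
[cite: Hirahara2022PartialMCSP, proof of Lemma 8.1 (via Hir20a Prop. 70)] -/
theorem gap_eq {C : ℕ} {M : (Fin N → Bool) → ℕ} (hM : ∀ v, M v ≤ C) (A : (Fin N → Bool) → Bool → Bool)
    (f : (Fin N → Bool) → Bool) :
    2 * C * ∑ v, b2i (A v (f v)) - ∑ v, ∑ ω : Fin C × Bool, b2i (A v (fM C M f v ω)) =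
      ∑ v, (M v : ℤ) * (b2i (A v (f v)) - b2i (A v (!f v))) := by
  rw [Finset.mul_sum, ← Finset.sum_sub_distrib]
  refine Finset.sum_congr rfl fun v _ => ?_
  rw [Fintype.sum_prod_type]
  have ht : ∀ t : Fin C, ∑ c : Bool, b2i (A v (fM C M f v (t, c))) =
      if t.val < M v then b2i (A v true) + b2i (A v false) else 2 * b2i (A v (f v)) := by
    intro t
    simp only [fM, Fintype.sum_bool]
    split_ifs with h
    · rfl
    · ring
  simp_rw [ht]
  rw [Finset.sum_ite, sum_const, sum_const, nsmul_eq_mul, nsmul_eq_mul]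
  have hlt : ((univ : Finset (Fin C)).filter fun t : Fin C => t.val < M v).card = M v := by
    rw [Fin.card_filter_val_lt, min_eq_right (hM v)]
  have hge : ((univ : Finset (Fin C)).filter fun t : Fin C => ¬t.val < M v).card = C - M v := by
    have := Finset.card_filter_add_card_filter_not (s := (univ : Finset (Fin C)))
      (fun t : Fin C => t.val < M v)
    rw [hlt, card_univ, Fintype.card_fin] at this
    omega
  rw [hlt, hge]
  have hcast : ((C - M v : ℕ) : ℤ) = C - M v := by have := hM v; omega
  rw [hcast]
  rcases Bool.eq_false_or_eq_true (A v true) with h1 | h1 <;>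
    rcases Bool.eq_false_or_eq_true (A v false) with h0 | h0 <;>
      cases hf : f v <;> simp [b2i, h1, h0] <;> ring

/-- **Prop. 70 (counting form): a one-query distinguisher between `(v, f v)` and `(v, f_M(v))` yields
a predictor with advantage on `M`.** For some tie-break bit `c`,
`∑ᵥ M(v) ([A(v,f v)] - [A(v,¬f v)]) ≤ ∑ᵥ M(v) σ_{pred A c}(v)` (`σ` the `±1` correctness sign of
`HardCoreLemma.lean`); combined with `gap_eq`, a distinguishing gap `η` (normalised) gives
`∑ M σ_P ≥ 2 C 2ᴺ η`. [cite: Hirahara2022PartialMCSP, proof of Lemma 8.1 (via Hir20a Prop. 70)] -/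
theorem exists_pred_adv_ge (M : (Fin N → Bool) → ℕ) (A : (Fin N → Bool) → Bool → Bool)
    (f : (Fin N → Bool) → Bool) :
    ∃ c : Bool, ∑ v, (M v : ℤ) * (b2i (A v (f v)) - b2i (A v (!f v))) ≤
      ∑ v, (M v : ℤ) * HardCore.sgn f (pred A c) v := by
  -- on points where `A(v,1) ≠ A(v,0)` the two summands agree; on ties the left one vanishes and the
  -- right one is `± M v` with opposite signs for `c = 0, 1`
  set tie := fun v : Fin N → Bool => A v true = A v false with htie
  have hdiff : ∀ v, ¬tie v →
      ∀ c, (M v : ℤ) * (b2i (A v (f v)) - b2i (A v (!f v))) = (M v : ℤ) * HardCore.sgn f (pred A c) v := by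
    intro v hv c
    have hv' : A v true ≠ A v false := hv
    congr 1
    simp only [pred, HardCore.sgn, b2i, if_neg hv']
    rcases Bool.eq_false_or_eq_true (A v true) with h1 | h1 <;>
      rcases Bool.eq_false_or_eq_true (A v false) with h0 | h0 <;>
        cases hf : f v <;> simp [h1, h0] at hv' ⊢
  have htie0 : ∀ v, tie v → (M v : ℤ) * (b2i (A v (f v)) - b2i (A v (!f v))) = 0 := by
    intro v hv
    have : A v (f v) = A v (!f v) := by cases f v <;> [exact hv.symm; exact hv]
    rw [this, sub_self, mul_zero]
  have htie1 : ∀ v, tie v → (M v : ℤ) * HardCore.sgn f (pred A true) v =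
      -((M v : ℤ) * HardCore.sgn f (pred A false) v) := by
    intro v hv
    have hv' : A v true = A v false := hv
    have hp : ∀ c, pred A c v = c := fun c => by simp [pred, hv']
    simp only [HardCore.sgn, hp]
    cases f v <;> simp
  classical
  -- split all sums into tie / non-tie parts
  have hsplit : ∀ g : (Fin N → Bool) → ℤ, ∑ v, g v =
      ∑ v ∈ univ.filter tie, g v + ∑ v ∈ univ.filter (fun v => ¬tie v), g v :=
    fun g => (Finset.sum_filter_add_sum_filter_not _ _ _).symm
  set S := ∑ v ∈ univ.filter tie, (M v : ℤ) * HardCore.sgn f (pred A false) v with hS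
  by_cases hS0 : 0 ≤ S
  · refine ⟨false, ?_⟩
    rw [hsplit, hsplit (fun v => (M v : ℤ) * HardCore.sgn f (pred A false) v), ← hS]
    rw [Finset.sum_eq_zero fun v hv => htie0 v (mem_filter.1 hv).2, zero_add]
    rw [Finset.sum_congr rfl fun v hv => hdiff v (mem_filter.1 hv).2 false]
    linarith
  · refine ⟨true, ?_⟩
    rw [hsplit, hsplit (fun v => (M v : ℤ) * HardCore.sgn f (pred A true) v)]
    rw [Finset.sum_eq_zero fun v hv => htie0 v (mem_filter.1 hv).2, zero_add]
    rw [Finset.sum_congr rfl fun v hv => hdiff v (mem_filter.1 hv).2 true]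
    have : ∑ v ∈ univ.filter tie, (M v : ℤ) * HardCore.sgn f (pred A true) v = -S := by
      rw [hS, ← Finset.sum_neg_distrib]
      exact Finset.sum_congr rfl fun v hv => htie1 v (mem_filter.1 hv).2
    rw [this]
    linarith

end IWAmp

end Literature.Computability.Complexity
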